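import Summits.BirchSwinnertonDyer.BirchSwinnertonDyer.Theorems.PrintCf2RubinValueTwoLinePinLineTrivialJunction
import Summits.BirchSwinnertonDyer.BirchSwinnertonDyer.Theorems.PrintCf2RubinValueTwoTwoVariableDualModuleFinite
import Summits.BirchSwinnertonDyer.BirchSwinnertonDyer.Theorems.PrintCf2RubinValueTwoLinePinDefectTorsionOfLine
import Literature.NumberTheory.EllipticCurves.Muller2020.TrivialBranch
import Literature.NumberTheory.EllipticCurves.KellerYin2024.CharacterSelmerGroups
import Literature.NumberTheory.EllipticCurves.GreenbergSelmerCharIdealPrincipalProofs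
import Literature.NumberTheory.IwasawaTheory.IwasawaAlgebraTwoVarRegularProofs
import Literature.NumberTheory.QuadraticFields.HeegnerCondition
import HarnessLib

/-!
# M-LINE-PIN, stub (T) `stub_thetaLine` of `Cruxes/MainConjClauseAtSplitTwoQuad/Lines/m_line_pin.lean` (LEAD cf2-p1 g14, v1) — THE `θ = 1` HALF
# COMPOSED from its displayed research/analytic inputs: (Q_T) ⊗ℚ-form ∧ (R) inner regularity ∧ (M₀) Müller χ = 1 (named fact) ∧ (A_T) restriction

Cell `bsd-print-cf2`, WIDTH seat `bsd-line-cf2-p1-w5` g8 (prover-bsd-line-cf2-p1-w5-g8-0). Helper, Theses-free, `--supports` the M-LINE-PIN item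
(24086 / its R-DA7 re-text). HONEST FRAMING: this is the `θ = 1` branch of the DA7 clause on DOUBLY ADAPTED `ℚ(√−7)`-frames (the binders of
`MLinePin.stub_thetaLine` with `∀ σ, θ σ = 1` in place of `θ² = 1 ∧ θ|_{ker κ₁} = 1`), proved from FOUR DISPLAYED INPUTS, exactly parallel to
LEAD g14's kernel-checked composition `MLinePin.mainConjClauseDA7_of_stubs` for `θ|_{ker κ₁} ≠ 1`:
* (M₀) `hM₀ : Muller2020.thm13_trivialChar_exists_nuPseudoBranch_charIdeal_eq` — ty2 g35's NAMED FACT (p705308; Müller 2020 Thm. 1.1/1.3 at `χ = 1`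
  on the MEASURE `(1−γ)ν(1)`): a CONDITIONAL input (print, +0 here: the fact is declared in Literature);
* (R) `hR` — inner `T₂`-regularity of the dual data (= `MLinePin.stub_xRegularInner` read on the frame; fact-free road via the swapped pair);
* (Q_T) `hQ` — the ⊗ℚ-form `(2^a F^J) = (2^b G₂)` AT `θ = 1` (= `MLinePin.stub_powForm` WITHOUT its binder `∃ σ ∈ κ₁.kerSubgroup, θ σ ≠ 1`:
  RESEARCH, the two-variable [MC] up to a power of 2 for the trivial branch);
* (A_T) `hA` — the analytic restriction at the trivial branch: for Müller's pseudo-branch datum `(Ω′, Ωp′, G₁)` generating the line data after `J`,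
  `G₂(T₁,0) ≠ 0 ∧ (G₂(T₁,0)) = (G₁)` (de Shalit II.4.12 restriction; ty2 g35: `(1 − (1+T)⁻¹)·π_v(G₂) ∼ E_v̄·G`, `E_v̄ ∈ T·Λˣ` on an undecomposed `v̄`;
  the `T`-type twin of `MLinePin.stub_vLineRestriction`).
The X-side is NOT an input: `…LinePinLineTrivialJunction.map_charIdeal_eq_span_of_powForm_charModule_of_frame_of_kerTrivial` (exact slot-1 control
for characters of the line, `ker φ̄ = ⊥`, `π_v(ch D.X) = ch D₁.X`, (C5′) with inner regularity, socket p695043). The DA7 frame (`NumberField.discr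
K = −7`, no curve) is bridged to cf2c-w8 g4's frame lemmas (`θ_K² = −7`, a `cm7`-twist) by `Quadratic.exists_sq_eq_discr` and `W := cm7^{(1)}`.
NOT here: the second character of the line `θ = χ_v` (needs the `CharTwist` transport `DualData₂(A_χ) ↔ DualData₂(A_1)` along `T₁ ↦ −(1+T₁) − 1`
or Müller typed at `χ_v`). No summit statement is proved by this seat; 24086 is open research; BSD is not proved by any of this. THEOREMS ONLY.
presearch: as in `…LinePinThetaOne`; Müller 2020 Def. 2.5 / Cor. 4.3 [corpus: paper:arxiv-2002.05647 p0006–p0007, p0015]. beyond-print theorem: no.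

References: [Mueller2020MCSplitTwo] Thm. 1.1/1.3, Def. 2.5; [deShalit1987] II.4.12; [GreenbergLNM1716] §3–4; [Washington1997] §13.1–13.2.
-/

noncomputable section

open scoped Classical Pointwise

-- the summit namespace `Summit.BirchSwinnertonDyer.BirchSwinnertonDyer` repeats the problem name by design (D-0017)
set_option linter.dupNamespace false
set_option autoImplicit false

open NumberField IsDedekindDomain Field WeierstrassCurve Literature.NumberTheory.GaloisRepresentations
  Literature.NumberTheory.EllipticCurves Literature.NumberTheory.EllipticCurves.GreenbergSelmer
  Literature.NumberTheory.EllipticCurves.GreenbergVatsal2000 Literature.NumberTheory.EllipticCurves.KellerYin2024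
  Literature.NumberTheory.EllipticCurves.IwasawaDual Literature.NumberTheory.EllipticCurves.Module
  Literature.NumberTheory.EllipticCurves.DeShalit1987 Literature.NumberTheory.EllipticCurves.Muller2020
  Literature.NumberTheory.QuadraticFields
  Summit.BirchSwinnertonDyer.BirchSwinnertonDyer.Theorems.PrintCf2.LinePinControl
  Summit.BirchSwinnertonDyer.BirchSwinnertonDyer.Theorems.PrintCf2.LinePin
  Summit.BirchSwinnertonDyer.BirchSwinnertonDyer.Theorems.PrintCf2

namespace Summit.BirchSwinnertonDyer.BirchSwinnertonDyer.Theorems.PrintCf2.LinePinThetaOne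

/-- **`stub_thetaLine`, THE `θ = 1` HALF, FROM ITS DISPLAYED INPUTS.** On a DA7 frame of `m_line_pin` (`K` imaginary quadratic, `h_K` odd,
`discr K = −7`, `2 = v v̄` with `v` induced by `ι`, periods `(Ω, δ, Ωp)`, doubly adapted pair `κ₁` THE `v`-line / `κ₂` THE `v̄`-line with `γ₁ ∈ I_v`,
`γ₂ ∈ I_v̄`), for the TRIVIAL character `θ` (`θ σ = 1`), its Hecke avatar `θ_K`, tame set `S`, every two-variable Katz measure `G₂` of the `θ_K⁻¹`-branch and
every dual datum `D` of `H¹_nr(K̃_∞, A_θ)`: GIVEN (M₀) Müller's trivial-character fact, (R) inner regularity, (Q_T) the ⊗ℚ-form at `θ = 1` and (A_T)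
the trivial-branch restriction `G₂(T₁,0) ≠ 0 ∧ (G₂(T₁,0)) = (G₁)` for Müller's pseudo-branch `G₁`, the DA7 clause holds: `D.X` is f.g. torsion and
`(ch_{Λ₂} D.X).map (map (map J)) = (G₂)` for every structure-compatible `J`. [cite: Mueller2020MCSplitTwo, Thm. 1.1, Def. 2.5]
[cite: deShalit1987, II.4.12] [cite: GreenbergLNM1716, §3–4] [cite: Washington1997, §13.2] -/
theorem thetaLine_of_inputs_of_apply_eq_one (hM₀ : Muller2020.thm13_trivialChar_exists_nuPseudoBranch_charIdeal_eq) :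
    ∀ (K : Type) [Field K] [NumberField K], IsImaginaryQuadratic K → ¬ 2 ∣ NumberField.classNumber K →
      NumberField.discr K = -7 →
    ∀ (ι : PadicAlgCl 2 ≃+* ℂ) (v vbar : HeightOneSpectrum (𝓞 K)),
      ((2 : ℕ) : 𝓞 K) ∈ v.asIdeal → ((2 : ℕ) : 𝓞 K) ∈ vbar.asIdeal → vbar ≠ v →
      (∀ (w : InfinitePlace K) (k : 𝓞 K), k ∈ v.asIdeal ↔ ‖ι.symm (w.embedding (k : K))‖ < 1) →
    ∀ (Ω δ : ℂ) (Ωp : (unrIntegers 2)ˣ), Ω ≠ 0 →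
      (δ ^ 2 = (NumberField.discr K : ℂ) ∨ δ ^ 2 = -(NumberField.discr K : ℂ)) →
    ∀ (κ₁ κ₂ : ZpExtension K 2) (γ₁ γ₂ : absoluteGaloisGroup K),
      ZpExtension.IsTopGeneratorPair κ₁ κ₂ γ₁ γ₂ → κ₂.IsUnramifiedOutside vbar →
      κ₁.IsUnramifiedOutside v → γ₁ ∈ GreenbergSelmer.inertia v → γ₂ ∈ GreenbergSelmer.inertia vbar →
    ∀ (θ : FramedGaloisRep K (padicCoeffIntegers (∅ : Set (PadicAlgCl 2))) 1),
      (∀ σ : absoluteGaloisGroup K, θ σ = 1) →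
    ∀ (θK : HeckeCharacter K), KellerYin2024.IsHeckeCharOf ι θ θK →
    ∀ (S : Finset (HeightOneSpectrum (𝓞 K))), v ∉ S → vbar ∉ S →
      (∀ w ∈ S, ¬ θK.IsUnramifiedAt w) →
      (∀ w : HeightOneSpectrum (𝓞 K), w ∉ S → w ≠ v → w ≠ vbar → θK.IsUnramifiedAt w) →
    ∀ G₂ : PowerSeries (PowerSeries (PadicComplexInt 2)),
      IsKatzMeasure₂ ι v vbar S κ₁ κ₂ γ₁⁻¹ γ₂⁻¹ θK⁻¹ Ω δ ((Ωp : unrIntegers 2) : ℂ_[2]) G₂ →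
    -- (R) inner `T₂`-regularity of the two-variable dual data (= `MLinePin.stub_xRegularInner` on this frame)
    (∀ D : DualData₂ κ₁ κ₂ (KellerYin2024.charModule (∅ : Set (PadicAlgCl 2)) θ) vbar γ₁ γ₂,
      Module.Finite (IwasawaAlgebra₂ 2) D.X → Module.IsTorsion (IwasawaAlgebra₂ 2) D.X →
      ∀ x : D.X, (PowerSeries.C (PowerSeries.X : IwasawaAlgebra 2) : IwasawaAlgebra₂ 2) • x = 0 → x = 0) →
    -- (Q_T) the ⊗ℚ-form at the trivial character (= `MLinePin.stub_powForm` without its non-triviality binder)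
    (∀ D : DualData₂ κ₁ κ₂ (KellerYin2024.charModule (∅ : Set (PadicAlgCl 2)) θ) vbar γ₁ γ₂,
      Module.Finite (IwasawaAlgebra₂ 2) D.X → Module.IsTorsion (IwasawaAlgebra₂ 2) D.X →
      ∀ F : IwasawaAlgebra₂ 2, Module.charIdeal (IwasawaAlgebra₂ 2) D.X = Ideal.span {F} →
      ∀ (J : ℤ_[2] →+* PadicComplexInt 2), (∀ x : ℤ_[2], ((J x : PadicComplexInt 2) : ℂ_[2]) = ((x : ℚ_[2]) : ℂ_[2])) →
      ∃ a b : ℕ, Ideal.span ({((2 : ℕ) : PowerSeries (PowerSeries (PadicComplexInt 2))) ^ a *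
          PowerSeries.map (PowerSeries.map J) F} : Set (PowerSeries (PowerSeries (PadicComplexInt 2)))) =
        Ideal.span {((2 : ℕ) : PowerSeries (PowerSeries (PadicComplexInt 2))) ^ b * G₂}) →
    -- (A_T) the analytic restriction at the trivial branch, for Müller's pseudo-branch datum
    (∀ (Ω' : ℂ) (Ωp' : (unrIntegers 2)ˣ) (G₁ : PowerSeries (PadicComplexInt 2)), Ω' ≠ 0 →
      IsNuPseudoBranch ι v κ₁ γ₁⁻¹ θK⁻¹ Ω' ((Ωp' : unrIntegers 2) : ℂ_[2]) G₁ →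
      (∀ D₁ : DatumDualData κ₁ γ₁ (KellerYin2024.charModule (∅ : Set (PadicAlgCl 2)) θ)
          (Castella2018.AcSelmer.bdpData (KellerYin2024.charModule (∅ : Set (PadicAlgCl 2)) θ) 2 vbar) ∅,
        Module.Finite (IwasawaAlgebra 2) D₁.X ∧ Module.IsTorsion (IwasawaAlgebra 2) D₁.X ∧
        ∀ (J : ℤ_[2] →+* PadicComplexInt 2), (∀ x : ℤ_[2], ((J x : PadicComplexInt 2) : ℂ_[2]) = ((x : ℚ_[2]) : ℂ_[2])) →
          (Module.charIdeal (IwasawaAlgebra 2) D₁.X).map (PowerSeries.map J) = Ideal.span {G₁}) →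
      PowerSeries.map (PowerSeries.constantCoeff (R := PadicComplexInt 2)) G₂ ≠ 0 ∧
      Ideal.span ({PowerSeries.map (PowerSeries.constantCoeff (R := PadicComplexInt 2)) G₂} : Set (PowerSeries (PadicComplexInt 2))) =
        Ideal.span {G₁}) →
    ∀ D : DualData₂ κ₁ κ₂ (KellerYin2024.charModule (∅ : Set (PadicAlgCl 2)) θ) vbar γ₁ γ₂,
      Module.Finite (IwasawaAlgebra₂ 2) D.X ∧ Module.IsTorsion (IwasawaAlgebra₂ 2) D.X ∧
      ∀ (J : ℤ_[2] →+* PadicComplexInt 2),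
        (∀ x : ℤ_[2], ((J x : PadicComplexInt 2) : ℂ_[2]) = ((x : ℚ_[2]) : ℂ_[2])) →
        (Module.charIdeal (IwasawaAlgebra₂ 2) D.X).map (PowerSeries.map (PowerSeries.map J)) = Ideal.span {G₂} := by
  intro K _ _ hK _h2K hdK ι v vbar hv hvbar hne hι Ω δ Ωp _hΩ _hδ κ₁ κ₂ γ₁ γ₂ hpair hκ₂ hκ₁ _hγ₁ hγ₂ θ hθ1 θK hθK S _hvS _hvbarS
    _hSram _hSunr G₂ _hG₂ hR hQ hA D
  have hθ2 : ∀ σ : absoluteGaloisGroup K, θ σ ^ 2 = 1 := fun σ ↦ by rw [hθ1 σ, one_pow]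
  -- finite generation (p694983)
  haveI hfg : Module.Finite (IwasawaAlgebra₂ 2) D.X :=
    TwoVarDualFinite.module_finite_dualData₂_charModule_two κ₁ κ₂ γ₁ γ₂ hpair θ hθ2 vbar D
  -- (M₀) Müller's trivial-character datum on the `v`-line
  obtain ⟨Ω', Ωp', G₁, hΩ', hNu, hMul⟩ := hM₀ K hK ι v vbar hv hvbar hne hι κ₁ hκ₁ γ₁ hpair.1 θ hθ1 θK hθK
  -- a line datum (to read Müller's torsion), torsion of `D.X`
  obtain ⟨D₀⟩ := KellerYin2024.nonempty_unrDualData_char (p := 2) (∅ : Set (PadicAlgCl 2)) θ κ₁ vbar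
    (∅ : Set (HeightOneSpectrum (𝓞 K))) hpair.1
  have hD₀ : Module.IsTorsion (IwasawaAlgebra 2) D₀.X := (hMul D₀).2.1
  have htors : Module.IsTorsion (IwasawaAlgebra₂ 2) D.X :=
    LinePinDefect.isTorsion_dualData₂_charModule_of_isTorsion_line hK hvbar hpair hκ₂ θ two_pos hθ2 D₀ hD₀ D
  refine ⟨hfg, htors, fun J hJ ↦ ?_⟩
  -- principal generator of `ch_{Λ₂} D.X`
  haveI : UniqueFactorizationMonoid (IwasawaAlgebra₂ 2) :=
    Literature.NumberTheory.IwasawaTheory.uniqueFactorizationMonoid_iwasawaAlgebraTwoVar 2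
  haveI hP := Literature.NumberTheory.EllipticCurves.Module.isPrincipal_charIdeal_of_uniqueFactorizationMonoid (IwasawaAlgebra₂ 2) D.X
  obtain ⟨F, hF⟩ := Submodule.IsPrincipal.principal (Module.charIdeal (IwasawaAlgebra₂ 2) D.X)
  change Module.charIdeal (IwasawaAlgebra₂ 2) D.X = Ideal.span {F} at hF
  -- (Q_T), (R), (A_T)
  obtain ⟨a, b, hQ'⟩ := hQ D hfg htors F hF J hJ
  have hX := hR D hfg htors
  obtain ⟨hπne, hA'⟩ := hA Ω' Ωp' G₁ hΩ' hNu hMul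
  have hM := (hMul D₀).2.2 J hJ
  have hG₁ : G₁ ≠ 0 := by
    intro hG
    rw [hG, Ideal.span_singleton_eq_span_singleton] at hA'
    exact hπne ((associated_zero_iff_eq_zero _).mp hA')
  -- the (C1) data: slot-1 control and its transpose into `D₀`
  have hprim : ∀ m : charModule (∅ : Set (PadicAlgCl 2)) θ, ∃ k : ℕ, 2 ^ k • m = 0 :=
    fun m ↦ exists_pow_smul_cofree_eq_zero (∅ : Set (PadicAlgCl 2)) θ m
  have hstab : ∀ m : charModule (∅ : Set (PadicAlgCl 2)) θ,
      IsOpen (MulAction.stabilizer (absoluteGaloisGroup K) m : Set (absoluteGaloisGroup K)) :=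
    fun m ↦ isOpen_stabilizer_cofree (∅ : Set (PadicAlgCl 2)) θ m
  obtain ⟨g, hg⟩ := LinePinControl.exists_lineRes_unr κ₁ κ₂ (charModule (∅ : Set (PadicAlgCl 2)) θ) vbar
  obtain ⟨φ, hφ⟩ := LinePinControl.exists_transpose_unr hg hpair hprim hstab D D₀
  -- bridge the DA7 frame to the `cm7`-frame currency: `θ_K² = −7` from the discriminant, `W := cm7^{(1)}`
  obtain ⟨-, -, δ₀, -, hδ₀⟩ := Quadratic.exists_sq_eq_discr (K := K) hK.1
  have hθK7 : ((δ₀ : 𝓞 K) : K) ^ 2 = -7 := by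
    have h := congrArg (algebraMap (𝓞 K) K) hδ₀
    rw [map_pow, map_intCast, hdK] at h
    rw [h]; norm_num
  haveI : (cm7.quadraticTwist (((1 : ℤ) : ℚ))).IsElliptic := cm7.isElliptic_quadraticTwist (by norm_num)
  have hCW : (1 : VariableChange ℚ) • cm7.quadraticTwist (((1 : ℤ) : ℚ)) = cm7.quadraticTwist (((1 : ℤ) : ℚ)) := one_smul _ _
  exact (map_charIdeal_eq_span_of_powForm_charModule_of_frame_of_kerTrivial hK hθK7 one_ne_zero (cm7.quadraticTwist (((1 : ℤ) : ℚ))) hCW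
    hv hvbar hne hκ₁ hκ₂ hpair hγ₂ θ hθ2 (fun σ _ ↦ hθ1 σ) hg hφ hX J G₂ F hF hQ' hD₀ G₁ hG₁ hM hA').2.2

end Summit.BirchSwinnertonDyer.BirchSwinnertonDyer.Theorems.PrintCf2.LinePinThetaOne

end
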